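import Summits.QuantumFields.YangMills.Theorems.UnitScaleTiltFluctuationComparisonRegPrLiftFaceRow

/-!
# Route `UnitScaleTilt` — crux K1bR-pr `FluctuationComparisonRegPr` (stmt-QuantumFields-19201), stub `stub_oneStepSmallLift`
# (W7 line), piece (L2), layer F6: THE NON-ABELIAN BIANCHI IDENTITY OF A LATTICE CUBE and the second-order smallness of the coarse
# `d₂` of the transported plaquette logarithms (support file `--supports stmt-QuantumFields-19201`)

Fleet seat `ym-ust-19201-p1` gen 2 (CARD-19201-oneStepSmallLift-L1L2 §1 «NON-EXACT INPUT»: the certified row bounds hold modulo coarse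
2-boundaries, so the lattice Bianchi defect `d₂c_V = O(δ²)` of the coarse plaquette logarithms enters with the boundary-chain mass `|e|₁`).

* §1 `norm_prodOnePlus_sub_le`: `‖Π(1+Y_i) − 1 − ΣY_i‖ ≤ (1+y)^n − 1 − n·y` for a list with `‖Y_i‖ ≤ y` (any normed ring).
* §2 **`cube_bianchi`** (any group-valued lattice field, any three directions `a < b < c`, any site `z`):
  `Ad_{U(z,a)}U(∂p_{bc}(z+e_a)) · U(∂p_{ac}(z)) · Ad_{U(z,c)}U(∂p_{ab}(z+e_c)) · U(∂p_{bc}(z))⁻¹ · Ad_{U(z,b)}U(∂p_{ac}(z+e_b))⁻¹ · U(∂p_{ab}(z))⁻¹ = 1`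
  (the word was found by a free-group search; `group` checks it).
* §3 **`norm_cubeLog_le`**: for a `δ`-small `SU(N)` field (`δ ≤ 1/3`), the signed sum of the six face LOGARITHMS, the shifted faces transported
  to `z` along one edge, has norm `≤ 75·δ²`; §4 `d2` of an orientation/displacement-indexed matrix field and **`norm_d2_wlogZ_le`**: for the
  transported logarithms `wlogZ V y` of layer F5b, `‖(d₂ wlogZ V y)(a<b<c; m)‖ ≤ 75δ² + 3·unification` (`|m|∞ ≤ N`).

Elementary; nothing of Bałaban's is asserted.
-/

noncomputable section

open scoped BigOperators Matrix.Norms.L2Operator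
open NormedSpace

namespace Summit.QuantumFields.YangMills.Theorems.ApproxLift

open Literature.MathematicalPhysics.QuantumFieldTheory.Balaban1983to89
open T4Continuum BlockAveraging AveragingRT B10Eq47AxialChi BlockAveragingSection BlockAveragingSectionPlaq ExpMeanLog MatrixLog

variable {P : Params} {j : ℕ}

/-! ## §1 Products of near-identity elements to second order (lists) -/

section Prod

variable {𝔸 : Type*} [NormedRing 𝔸] [NormOneClass 𝔸]

/-- `‖Π(1+Y_i) − 1‖ ≤ (1+y)^n − 1` for `‖Y_i‖ ≤ y`. -/
theorem norm_prodOnePlus_sub_one_le {y : ℝ} (hy : 0 ≤ y) :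
    ∀ l : List 𝔸, (∀ Y ∈ l, ‖Y‖ ≤ y) → ‖(l.map fun Y => 1 + Y).prod - 1‖ ≤ (1 + y) ^ l.length - 1
  | [], _ => by simp
  | Y :: l, h => by
    have hY : ‖Y‖ ≤ y := h Y List.mem_cons_self
    have ih := norm_prodOnePlus_sub_one_le hy l fun Z hZ => h Z (List.mem_cons_of_mem Y hZ)
    rw [List.map_cons, List.prod_cons, List.length_cons, pow_succ]
    set Q := (l.map fun Y => 1 + Y).prod with hQ
    have hQ1 : ‖Q‖ ≤ (1 + y) ^ l.length := by
      have : Q = (Q - 1) + 1 := by abel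
      rw [this]
      exact (norm_add_le _ _).trans (by rw [norm_one]; linarith)
    have hsplit : (1 + Y) * Q - 1 = (Q - 1) + Y * Q := by noncomm_ring
    rw [hsplit]
    calc _ ≤ ‖Q - 1‖ + ‖Y * Q‖ := norm_add_le _ _
      _ ≤ ((1 + y) ^ l.length - 1) + y * (1 + y) ^ l.length :=
          add_le_add ih ((norm_mul_le _ _).trans (mul_le_mul hY hQ1 (norm_nonneg _) hy))
      _ = (1 + y) ^ l.length * (1 + y) - 1 := by ring

/-- **`‖Π(1+Y_i) − 1 − ΣY_i‖ ≤ (1+y)^n − 1 − n·y`** for `‖Y_i‖ ≤ y`. -/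
theorem norm_prodOnePlus_sub_le {y : ℝ} (hy : 0 ≤ y) :
    ∀ l : List 𝔸, (∀ Y ∈ l, ‖Y‖ ≤ y) → ‖(l.map fun Y => 1 + Y).prod - 1 - l.sum‖ ≤ (1 + y) ^ l.length - 1 - l.length * y
  | [], _ => by simp
  | Y :: l, h => by
    have hY : ‖Y‖ ≤ y := h Y List.mem_cons_self
    have h' : ∀ Z ∈ l, ‖Z‖ ≤ y := fun Z hZ => h Z (List.mem_cons_of_mem Y hZ)
    have ih := norm_prodOnePlus_sub_le hy l h'
    have ih1 := norm_prodOnePlus_sub_one_le hy l h'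
    rw [List.map_cons, List.prod_cons, List.sum_cons, List.length_cons, pow_succ, Nat.cast_succ]
    set Q := (l.map fun Y => 1 + Y).prod with hQ
    have hsplit : (1 + Y) * Q - 1 - (Y + l.sum) = (Q - 1 - l.sum) + Y * (Q - 1) := by noncomm_ring
    rw [hsplit]
    calc _ ≤ ‖Q - 1 - l.sum‖ + ‖Y * (Q - 1)‖ := norm_add_le _ _
      _ ≤ ((1 + y) ^ l.length - 1 - l.length * y) + y * ((1 + y) ^ l.length - 1) :=
          add_le_add ih ((norm_mul_le _ _).trans (mul_le_mul hY ih1 (norm_nonneg _) hy))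
      _ = (1 + y) ^ l.length * (1 + y) - 1 - (l.length + 1) * y := by ring

/-- The six-factor case: `‖Π_{i≤6}(1+Y_i) − 1 − ΣY_i‖ ≤ (1+y)⁶ − 1 − 6y`. -/
theorem norm_prod_six_sub_le {y : ℝ} (hy : 0 ≤ y) (Y₁ Y₂ Y₃ Y₄ Y₅ Y₆ : 𝔸) (h₁ : ‖Y₁‖ ≤ y) (h₂ : ‖Y₂‖ ≤ y) (h₃ : ‖Y₃‖ ≤ y)
    (h₄ : ‖Y₄‖ ≤ y) (h₅ : ‖Y₅‖ ≤ y) (h₆ : ‖Y₆‖ ≤ y) :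
    ‖(1 + Y₁) * (1 + Y₂) * (1 + Y₃) * (1 + Y₄) * (1 + Y₅) * (1 + Y₆) - 1 - (Y₁ + Y₂ + Y₃ + Y₄ + Y₅ + Y₆)‖ ≤
      (1 + y) ^ 6 - 1 - 6 * y := by
  have hl := norm_prodOnePlus_sub_le hy [Y₁, Y₂, Y₃, Y₄, Y₅, Y₆] (by
    intro Y hY; simp only [List.mem_cons, List.not_mem_nil, or_false] at hY
    rcases hY with rfl | rfl | rfl | rfl | rfl | rfl <;> assumption)
  simp only [List.map_cons, List.map_nil, List.prod_cons, List.prod_nil, List.sum_cons, List.sum_nil, List.length_cons,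
    List.length_nil, mul_one, add_zero] at hl
  have hassoc : (1 + Y₁) * ((1 + Y₂) * ((1 + Y₃) * ((1 + Y₄) * ((1 + Y₅) * (1 + Y₆))))) =
      (1 + Y₁) * (1 + Y₂) * (1 + Y₃) * (1 + Y₄) * (1 + Y₅) * (1 + Y₆) := by simp only [mul_assoc]
  have hassoc' : Y₁ + (Y₂ + (Y₃ + (Y₄ + (Y₅ + Y₆)))) = Y₁ + Y₂ + Y₃ + Y₄ + Y₅ + Y₆ := by simp only [add_assoc]
  rw [hassoc, hassoc'] at hl
  refine hl.trans (le_of_eq ?_)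
  push_cast; ring

end Prod

/-! ## §2 The non-abelian Bianchi identity of a cube -/

section Cube

/-- `(x + e_a) + e_b = (x + e_b) + e_a`. -/
private theorem shift_shift_comm₆ (x : Site P (j + 1)) (a b : Fin P.d) : (x.shift a).shift b = (x.shift b).shift a := by
  funext i
  by_cases ha : i = a <;> by_cases hb : i = b
  · subst ha; subst hb; rfl
  · subst ha; simp [Site.shift, hb]
  · subst hb; simp [Site.shift, ha]
  · simp [Site.shift, ha, hb]

/-- **THE NON-ABELIAN BIANCHI IDENTITY OF THE LATTICE CUBE** at `z` spanned by `a < b < c`: the six face holonomies (tree convention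
`plaqHol`), the three far faces conjugated back to `z` along one edge, multiply to `1` in the order `bc(z+a), ac(z), ab(z+c), bc(z)⁻¹, ac(z+b)⁻¹, ab(z)⁻¹`. -/
theorem cube_bianchi {G : Type*} [GaugeGroup G] (U : GaugeField P (j + 1) G) (z : Site P (j + 1)) {a b c : Fin P.d} (hab : a < b)
    (hbc : b < c) :
    (U ⟨z, a⟩ * GaugeField.plaqHol U ⟨z.shift a, b, c, hbc⟩ * (U ⟨z, a⟩)⁻¹) * GaugeField.plaqHol U ⟨z, a, c, hab.trans hbc⟩ *
      (U ⟨z, c⟩ * GaugeField.plaqHol U ⟨z.shift c, a, b, hab⟩ * (U ⟨z, c⟩)⁻¹) * (GaugeField.plaqHol U ⟨z, b, c, hbc⟩)⁻¹ *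
      (U ⟨z, b⟩ * (GaugeField.plaqHol U ⟨z.shift b, a, c, hab.trans hbc⟩)⁻¹ * (U ⟨z, b⟩)⁻¹) * (GaugeField.plaqHol U ⟨z, a, b, hab⟩)⁻¹ = 1 := by
  unfold GaugeField.plaqHol
  simp only
  rw [shift_shift_comm₆ z c a, shift_shift_comm₆ z c b, shift_shift_comm₆ z b a]
  group

end Cube


/-! ## §3 The signed sum of the six face logarithms is second order -/

section CubeLog

variable {n : Type*} [Fintype n] [DecidableEq n] [Nonempty n]

/-- In the model, `dist1 g = ‖g − 1‖`. -/
private theorem dist1_su_eq₆ (g : Matrix.specialUnitaryGroup n ℂ) : dist1 g = ‖(g : Matrix n n ℂ) - 1‖ := rfl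

omit [Nonempty n] in
/-- `↑g * ↑g⁻¹ = 1` in the matrix model. -/
private theorem coe_mul_coe_inv₆ (g : Matrix.specialUnitaryGroup n ℂ) :
    (g : Matrix n n ℂ) * ((g⁻¹ : Matrix.specialUnitaryGroup n ℂ) : Matrix n n ℂ) = 1 := by
  rw [← Submonoid.coe_mul, mul_inv_cancel]; rfl

/-- `‖P⁻¹ − 1 + (P − 1)‖ ≤ ‖P − 1‖²` (`P⁻¹ + P − 2 = −(P−1)(P⁻¹−1)`). -/
theorem norm_inv_sub_one_add_sub_one_le (g : Matrix.specialUnitaryGroup n ℂ) :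
    ‖((g⁻¹ : Matrix.specialUnitaryGroup n ℂ) : Matrix n n ℂ) - 1 + ((g : Matrix n n ℂ) - 1)‖ ≤ dist1 g ^ 2 := by
  have h : ((g⁻¹ : Matrix.specialUnitaryGroup n ℂ) : Matrix n n ℂ) - 1 + ((g : Matrix n n ℂ) - 1) =
      -(((g : Matrix n n ℂ) - 1) * (((g⁻¹ : Matrix.specialUnitaryGroup n ℂ) : Matrix n n ℂ) - 1)) := by
    have := coe_mul_coe_inv₆ g
    noncomm_ring [this]
  rw [h, norm_neg]
  have hinv : dist1 g⁻¹ = dist1 g := GaugeGroup.dist1_inv g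
  rw [dist1_su_eq₆, dist1_su_eq₆] at hinv
  rw [dist1_su_eq₆, sq]
  exact (norm_mul_le _ _).trans (by rw [hinv])

/-- **ABSTRACT SIX-TERM BIANCHI ESTIMATE**: if six group elements satisfy the cube identity of `cube_bianchi` (with edge transports
`g_a, g_b, g_c`), each within `δ ≤ 1` of `1`, and `c_i` are within `2δ²` of `P_i − 1` (their logarithms), then the signed transported sum
`Ad_{g_a}c₁ − c₄ − (Ad_{g_b}c₅ − c₂) + (Ad_{g_c}c₃ − c₆)` has norm `≤ 72δ²`. -/
theorem norm_sixLog_le {δ : ℝ} (hδ0 : 0 ≤ δ) (hδ1 : δ ≤ 1) (ga gb gc P₁ P₂ P₃ P₄ P₅ P₆ : Matrix.specialUnitaryGroup n ℂ)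
    (hid : ga * P₁ * ga⁻¹ * P₂ * (gc * P₃ * gc⁻¹) * P₄⁻¹ * (gb * P₅⁻¹ * gb⁻¹) * P₆⁻¹ = 1)
    (h₁ : dist1 P₁ ≤ δ) (h₂ : dist1 P₂ ≤ δ) (h₃ : dist1 P₃ ≤ δ) (h₄ : dist1 P₄ ≤ δ) (h₅ : dist1 P₅ ≤ δ) (h₆ : dist1 P₆ ≤ δ)
    (c₁ c₂ c₃ c₄ c₅ c₆ : Matrix n n ℂ) (hc₁ : ‖c₁ - ((P₁ : Matrix n n ℂ) - 1)‖ ≤ 2 * δ ^ 2)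
    (hc₂ : ‖c₂ - ((P₂ : Matrix n n ℂ) - 1)‖ ≤ 2 * δ ^ 2) (hc₃ : ‖c₃ - ((P₃ : Matrix n n ℂ) - 1)‖ ≤ 2 * δ ^ 2)
    (hc₄ : ‖c₄ - ((P₄ : Matrix n n ℂ) - 1)‖ ≤ 2 * δ ^ 2) (hc₅ : ‖c₅ - ((P₅ : Matrix n n ℂ) - 1)‖ ≤ 2 * δ ^ 2)
    (hc₆ : ‖c₆ - ((P₆ : Matrix n n ℂ) - 1)‖ ≤ 2 * δ ^ 2) :
    ‖conjM ga c₁ - c₄ - (conjM gb c₅ - c₂) + (conjM gc c₃ - c₆)‖ ≤ 72 * δ ^ 2 := by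
  -- the six near-identity matrices
  obtain ⟨Y₁, hY₁⟩ : ∃ Y : Matrix n n ℂ, Y = conjM ga ((P₁ : Matrix n n ℂ) - 1) := ⟨_, rfl⟩
  obtain ⟨Y₂, hY₂⟩ : ∃ Y : Matrix n n ℂ, Y = (P₂ : Matrix n n ℂ) - 1 := ⟨_, rfl⟩
  obtain ⟨Y₃, hY₃⟩ : ∃ Y : Matrix n n ℂ, Y = conjM gc ((P₃ : Matrix n n ℂ) - 1) := ⟨_, rfl⟩
  obtain ⟨Y₄, hY₄⟩ : ∃ Y : Matrix n n ℂ, Y = ((P₄⁻¹ : Matrix.specialUnitaryGroup n ℂ) : Matrix n n ℂ) - 1 := ⟨_, rfl⟩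
  obtain ⟨Y₅, hY₅⟩ : ∃ Y : Matrix n n ℂ, Y = conjM gb (((P₅⁻¹ : Matrix.specialUnitaryGroup n ℂ) : Matrix n n ℂ) - 1) := ⟨_, rfl⟩
  obtain ⟨Y₆, hY₆⟩ : ∃ Y : Matrix n n ℂ, Y = ((P₆⁻¹ : Matrix.specialUnitaryGroup n ℂ) : Matrix n n ℂ) - 1 := ⟨_, rfl⟩
  have hprod : (1 + Y₁) * (1 + Y₂) * (1 + Y₃) * (1 + Y₄) * (1 + Y₅) * (1 + Y₆) = 1 := by
    have h := congrArg (fun g : Matrix.specialUnitaryGroup n ℂ => (g : Matrix n n ℂ)) hid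
    simp only [Submonoid.coe_mul, OneMemClass.coe_one] at h
    have e1 : 1 + Y₁ = (ga : Matrix n n ℂ) * (P₁ : Matrix n n ℂ) * ((ga⁻¹ : Matrix.specialUnitaryGroup n ℂ) : Matrix n n ℂ) := by
      rw [hY₁]; unfold conjM; have := coe_mul_coe_inv₆ ga; noncomm_ring [this]
    have e3 : 1 + Y₃ = (gc : Matrix n n ℂ) * (P₃ : Matrix n n ℂ) * ((gc⁻¹ : Matrix.specialUnitaryGroup n ℂ) : Matrix n n ℂ) := by
      rw [hY₃]; unfold conjM; have := coe_mul_coe_inv₆ gc; noncomm_ring [this]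
    have e5 : 1 + Y₅ = (gb : Matrix n n ℂ) * ((P₅⁻¹ : Matrix.specialUnitaryGroup n ℂ) : Matrix n n ℂ) *
        ((gb⁻¹ : Matrix.specialUnitaryGroup n ℂ) : Matrix n n ℂ) := by
      rw [hY₅]; unfold conjM; have := coe_mul_coe_inv₆ gb; noncomm_ring [this]
    have e2 : 1 + Y₂ = (P₂ : Matrix n n ℂ) := by rw [hY₂]; abel
    have e4 : 1 + Y₄ = ((P₄⁻¹ : Matrix.specialUnitaryGroup n ℂ) : Matrix n n ℂ) := by rw [hY₄]; abel
    have e6 : 1 + Y₆ = ((P₆⁻¹ : Matrix.specialUnitaryGroup n ℂ) : Matrix n n ℂ) := by rw [hY₆]; abel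
    rw [e1, e2, e3, e4, e5, e6]
    exact h
  -- sizes `‖Y_i‖ ≤ δ`
  have n1 : ‖Y₁‖ ≤ δ := by rw [hY₁]; exact (norm_conjM_le _ _).trans h₁
  have n2 : ‖Y₂‖ ≤ δ := by rw [hY₂]; exact h₂
  have n3 : ‖Y₃‖ ≤ δ := by rw [hY₃]; exact (norm_conjM_le _ _).trans h₃
  have n4 : ‖Y₄‖ ≤ δ := by rw [hY₄, ← dist1_su_eq₆, GaugeGroup.dist1_inv]; exact h₄
  have n5 : ‖Y₅‖ ≤ δ := by rw [hY₅]; exact (norm_conjM_le _ _).trans (by rw [← dist1_su_eq₆, GaugeGroup.dist1_inv]; exact h₅)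
  have n6 : ‖Y₆‖ ≤ δ := by rw [hY₆, ← dist1_su_eq₆, GaugeGroup.dist1_inv]; exact h₆
  -- `‖ΣY‖ ≤ 57δ²`
  have hsum : ‖Y₁ + Y₂ + Y₃ + Y₄ + Y₅ + Y₆‖ ≤ 57 * δ ^ 2 := by
    have hl := norm_prod_six_sub_le (𝔸 := Matrix n n ℂ) hδ0 Y₁ Y₂ Y₃ Y₄ Y₅ Y₆ n1 n2 n3 n4 n5 n6
    rw [hprod, sub_self, zero_sub, norm_neg] at hl
    refine hl.trans ?_
    nlinarith [hδ0, hδ1, sq_nonneg δ, mul_nonneg hδ0 (sq_nonneg δ), mul_nonneg (sq_nonneg δ) (sq_nonneg δ),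
      mul_nonneg (mul_nonneg hδ0 (sq_nonneg δ)) (sq_nonneg δ)]
  -- the inverse faces: `‖c + (P⁻¹ − 1)‖ ≤ 3δ²`
  have hinvface : ∀ (Q : Matrix.specialUnitaryGroup n ℂ) (c : Matrix n n ℂ), dist1 Q ≤ δ → ‖c - ((Q : Matrix n n ℂ) - 1)‖ ≤ 2 * δ ^ 2 →
      ‖c + (((Q⁻¹ : Matrix.specialUnitaryGroup n ℂ) : Matrix n n ℂ) - 1)‖ ≤ 3 * δ ^ 2 := fun Q c hQ hc => by
    have h2 := norm_inv_sub_one_add_sub_one_le Q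
    have h3 : dist1 Q ^ 2 ≤ δ ^ 2 := by gcongr; exact GaugeGroup.dist1_nonneg _
    have : c + (((Q⁻¹ : Matrix.specialUnitaryGroup n ℂ) : Matrix n n ℂ) - 1) =
        (c - ((Q : Matrix n n ℂ) - 1)) + ((((Q⁻¹ : Matrix.specialUnitaryGroup n ℂ) : Matrix n n ℂ) - 1) + ((Q : Matrix n n ℂ) - 1)) := by
      abel
    rw [this]
    exact (norm_add_le _ _).trans (by linarith)
  have t4 := hinvface P₄ c₄ h₄ hc₄
  have t5 := hinvface P₅ c₅ h₅ hc₅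
  have t6 := hinvface P₆ c₆ h₆ hc₆
  -- the difference to `ΣY`
  have hdiff : conjM ga c₁ - c₄ - (conjM gb c₅ - c₂) + (conjM gc c₃ - c₆) - (Y₁ + Y₂ + Y₃ + Y₄ + Y₅ + Y₆) =
      conjM ga (c₁ - ((P₁ : Matrix n n ℂ) - 1)) - (c₄ + (((P₄⁻¹ : Matrix.specialUnitaryGroup n ℂ) : Matrix n n ℂ) - 1)) -
        conjM gb (c₅ + (((P₅⁻¹ : Matrix.specialUnitaryGroup n ℂ) : Matrix n n ℂ) - 1)) + (c₂ - ((P₂ : Matrix n n ℂ) - 1)) +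
        conjM gc (c₃ - ((P₃ : Matrix n n ℂ) - 1)) - (c₆ + (((P₆⁻¹ : Matrix.specialUnitaryGroup n ℂ) : Matrix n n ℂ) - 1)) := by
    rw [hY₁, hY₂, hY₃, hY₄, hY₅, hY₆]
    simp only [conjM_sub, conjM_add]
    abel
  have hdn : ‖conjM ga c₁ - c₄ - (conjM gb c₅ - c₂) + (conjM gc c₃ - c₆) - (Y₁ + Y₂ + Y₃ + Y₄ + Y₅ + Y₆)‖ ≤ 15 * δ ^ 2 := by
    rw [hdiff]
    have t1 := (norm_conjM_le ga _).trans hc₁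
    have t5' := (norm_conjM_le gb _).trans t5
    have t3 := (norm_conjM_le gc _).trans hc₃
    calc _ ≤ ‖conjM ga (c₁ - ((P₁ : Matrix n n ℂ) - 1))‖ + ‖c₄ + (((P₄⁻¹ : Matrix.specialUnitaryGroup n ℂ) : Matrix n n ℂ) - 1)‖ +
          ‖conjM gb (c₅ + (((P₅⁻¹ : Matrix.specialUnitaryGroup n ℂ) : Matrix n n ℂ) - 1))‖ + ‖c₂ - ((P₂ : Matrix n n ℂ) - 1)‖ +
          ‖conjM gc (c₃ - ((P₃ : Matrix n n ℂ) - 1))‖ + ‖c₆ + (((P₆⁻¹ : Matrix.specialUnitaryGroup n ℂ) : Matrix n n ℂ) - 1)‖ := by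
          refine (norm_sub_le _ _).trans (add_le_add ?_ le_rfl)
          refine (norm_add_le _ _).trans (add_le_add ?_ le_rfl)
          refine (norm_add_le _ _).trans (add_le_add ?_ le_rfl)
          refine (norm_sub_le _ _).trans (add_le_add ?_ le_rfl)
          exact norm_sub_le _ _
      _ ≤ 2 * δ ^ 2 + 3 * δ ^ 2 + 3 * δ ^ 2 + 2 * δ ^ 2 + 2 * δ ^ 2 + 3 * δ ^ 2 := by gcongr
      _ = 15 * δ ^ 2 := by ring
  have : conjM ga c₁ - c₄ - (conjM gb c₅ - c₂) + (conjM gc c₃ - c₆) =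
      (conjM ga c₁ - c₄ - (conjM gb c₅ - c₂) + (conjM gc c₃ - c₆) - (Y₁ + Y₂ + Y₃ + Y₄ + Y₅ + Y₆)) + (Y₁ + Y₂ + Y₃ + Y₄ + Y₅ + Y₆) := by
    abel
  rw [this]
  exact (norm_add_le _ _).trans (by linarith)

/-- **THE LOCAL BIANCHI SUM OF LOGARITHMS** at the cube `(z; a<b<c)`: the signed six face logarithms, far faces transported to `z` along one
edge (signs of the coarse `d₂`: `+bc(z+a) − bc(z) − ac(z+b) + ac(z) + ab(z+c) − ab(z)`). -/
def cubeLog (V : GaugeField P (j + 1) (Matrix.specialUnitaryGroup n ℂ)) (z : Site P (j + 1)) (a b c : Fin P.d) (hab : a < b)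
    (hbc : b < c) : Matrix n n ℂ :=
  conjM (V ⟨z, a⟩) (clog V ⟨z.shift a, b, c, hbc⟩) - clog V ⟨z, b, c, hbc⟩ -
    (conjM (V ⟨z, b⟩) (clog V ⟨z.shift b, a, c, hab.trans hbc⟩) - clog V ⟨z, a, c, hab.trans hbc⟩) +
    (conjM (V ⟨z, c⟩) (clog V ⟨z.shift c, a, b, hab⟩) - clog V ⟨z, a, b, hab⟩)

/-- **THE LOCAL BIANCHI SUM IS SECOND ORDER**: `‖cubeLog‖ ≤ 72·δ²` on a `δ`-small `V` (`δ ≤ 1/3`). -/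
theorem norm_cubeLog_le {δ : ℝ} {V : GaugeField P (j + 1) (Matrix.specialUnitaryGroup n ℂ)} (hV : PlaqSmall δ V) (hδ : δ ≤ 1 / 3)
    (z : Site P (j + 1)) {a b c : Fin P.d} (hab : a < b) (hbc : b < c) : ‖cubeLog V z a b c hab hbc‖ ≤ 72 * δ ^ 2 := by
  have hδ0 : 0 ≤ δ := (GaugeGroup.dist1_nonneg _).trans (hV ⟨z, a, b, hab⟩).le
  have hd : ∀ Q : Plaq P (j + 1), dist1 (GaugeField.plaqHol V Q) ≤ δ := fun Q => (hV Q).le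
  have hl2 : ∀ Q : Plaq P (j + 1), ‖clog V Q - (((GaugeField.plaqHol V Q : Matrix.specialUnitaryGroup n ℂ) : Matrix n n ℂ) - 1)‖ ≤ 2 * δ ^ 2 :=
    fun Q => by
      have hQ : ‖((GaugeField.plaqHol V Q : Matrix.specialUnitaryGroup n ℂ) : Matrix n n ℂ) - 1‖ ≤ δ := hd Q
      unfold clog
      refine (Summit.QuantumFields.BalabanUV.Beta.EriceAxialGaugeWords.norm_mlog_sub_sub_one_le (hQ.trans (hδ.trans (by norm_num)))).trans ?_
      gcongr
  exact norm_sixLog_le hδ0 (hδ.trans (by norm_num)) _ _ _ _ _ _ _ _ _ (cube_bianchi V z hab hbc) (hd _) (hd _) (hd _) (hd _) (hd _) (hd _)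
    _ _ _ _ _ _ (hl2 _) (hl2 _) (hl2 _) (hl2 _) (hl2 _) (hl2 _)

end CubeLog



/-! ## §4 The coarse `d₂` of the transported logarithms is second order -/

section D2

variable {n : Type*} [Fintype n] [DecidableEq n] [Nonempty n]

/-- The unit integer vector `e_a`. -/
def unitZ {d : ℕ} (a : Fin d) : Fin d → ℤ := fun i => if i = a then 1 else 0

/-- **THE COARSE `d₂`** of an orientation/displacement-indexed matrix field at the cube `(m; a<b<c)` (the certificates' convention:
`+bc(m+e_a) − bc(m) − ac(m+e_b) + ac(m) + ab(m+e_c) − ab(m)`). -/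
def d2 {d : ℕ} (w : Orient d → (Fin d → ℤ) → Matrix n n ℂ) (a b c : Fin d) (hab : a < b) (hbc : b < c) (m : Fin d → ℤ) :
    Matrix n n ℂ :=
  w ⟨(b, c), hbc⟩ (m + unitZ a) - w ⟨(b, c), hbc⟩ m - (w ⟨(a, c), hab.trans hbc⟩ (m + unitZ b) - w ⟨(a, c), hab.trans hbc⟩ m) +
    (w ⟨(a, b), hab⟩ (m + unitZ c) - w ⟨(a, b), hab⟩ m)

/-- `y + (m + e_a) = (y + m) + e_a`. -/
theorem vadd_add_unitZ (y : Site P (j + 1)) (m : Fin P.d → ℤ) (a : Fin P.d) : vadd y (m + unitZ a) = (vadd y m).shift a := by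
  funext i
  unfold vadd unitZ
  by_cases h : i = a
  · subst h; simp [Site.shift, add_assoc]
  · simp [Site.shift, h]

/-- Monotonicity of the Stokes bound in the word length. -/
private theorem stokes_mono' {a b : ℕ} (h : a ≤ b) {δ : ℝ} (hδ : 0 ≤ δ) :
    (((a : ℕ) : ℝ) ^ 2 / 4) * δ ≤ (((b : ℕ) : ℝ) ^ 2 / 4) * δ := by
  have : ((a : ℕ) : ℝ) ≤ ((b : ℕ) : ℝ) := by exact_mod_cast h
  have ha : (0 : ℝ) ≤ ((a : ℕ) : ℝ) := Nat.cast_nonneg _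
  exact mul_le_mul_of_nonneg_right (by gcongr) hδ

/-- The staircase to `y + m` followed by the edge `e_a` transports like the staircase to `y + m + e_a`, up to a small closed holonomy:
the SHIFTED-FACE UNIFICATION `‖wlogZ V y o (m + e_a) − Ad_{V(Γ¹_{y,y+m})} Ad_{V(y+m, a)} log V(∂(o; y+m+e_a))‖ ≤ 2((ℓ²/4)δ)(2δ)`,
`ℓ = d(N+1) + dN + 1`, `|m|∞ ≤ N`. -/
theorem norm_wlogZ_shift_sub_le {δ : ℝ} (hδ0 : 0 ≤ δ) {V : GaugeField P (j + 1) (Matrix.specialUnitaryGroup n ℂ)} (hV : PlaqSmall δ V)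
    (hδ : δ ≤ 1 / 2) (y : Site P (j + 1)) (o : Orient P.d) (m : Fin P.d → ℤ) (a : Fin P.d) (N : ℕ) (hm : ∀ i, (m i).natAbs ≤ N) :
    ‖wlogZ V y o (m + unitZ a) -
        conjM (ctrans V y m) (conjM (V ⟨vadd y m, a⟩) (clog V ⟨(vadd y m).shift a, o.1.1, o.1.2, o.2⟩))‖ ≤
      2 * ((((P.d * (N + 1) + (P.d * N + 1) : ℕ) : ℝ) ^ 2 / 4) * δ) * (2 * δ) := by
  have hz : walkEnd y (stairWord 1 m) = vadd y m := by
    rw [walkEnd_eq_vadd]; congr 1; funext ν; exact netDisp_stairWord 1 m ν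
  have h1 : wlogZ V y o (m + unitZ a) =
      conjM (holAt V (walk y (stairWord 1 (m + unitZ a)))) (clog V ⟨(vadd y m).shift a, o.1.1, o.1.2, o.2⟩) := by
    unfold wlogZ ctrans plaqAt; rw [vadd_add_unitZ]
  have h2 : conjM (ctrans V y m) (conjM (V ⟨vadd y m, a⟩) (clog V ⟨(vadd y m).shift a, o.1.1, o.1.2, o.2⟩)) =
      conjM (holAt V (walk y (stairWord 1 m ++ [(a, true)]))) (clog V ⟨(vadd y m).shift a, o.1.1, o.1.2, o.2⟩) := by
    rw [← conjM_mul]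
    unfold ctrans
    rw [walk_append, holAt_append, hz]
    congr 2
    simp [walk, holAt_cons, holAt_nil]
  rw [h1, h2]
  have hnet : ∀ ν, netDisp (stairWord 1 (m + unitZ a)) ν = netDisp (stairWord 1 m ++ [(a, true)]) ν := fun ν => by
    rw [T4ReflectionCone.netDisp_append, netDisp_stairWord, netDisp_stairWord, Pi.add_apply]
    unfold unitZ netDisp
    by_cases h : ν = a
    · subst h; simp
    · simp [h, Ne.symm h]
  refine (norm_conjM_holAt_sub_le hδ0 hV y _ _ hnet _).trans ?_
  have hl1 : (stairWord (1 : Equiv.Perm (Fin P.d)) (m + unitZ a)).length ≤ P.d * (N + 1) :=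
    LatticeWordStokes.length_stairWord_le 1 _ (N + 1) fun i => by
      have := hm i; unfold unitZ; simp only [Pi.add_apply]; split_ifs <;> omega
  have hl2 : (stairWord (1 : Equiv.Perm (Fin P.d)) m ++ [(a, true)]).length ≤ P.d * N + 1 := by
    rw [List.length_append, List.length_singleton]
    exact add_le_add (LatticeWordStokes.length_stairWord_le 1 m N hm) le_rfl
  have hl : (stairWord (1 : Equiv.Perm (Fin P.d)) (m + unitZ a)).length + (stairWord (1 : Equiv.Perm (Fin P.d)) m ++ [(a, true)]).length ≤
      P.d * (N + 1) + (P.d * N + 1) := add_le_add hl1 hl2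
  have hmono := stokes_mono' hl hδ0
  exact mul_le_mul (mul_le_mul_of_nonneg_left hmono (by norm_num)) (norm_clog_le hV hδ _) (norm_nonneg _) (by positivity)

/-- **THE COARSE `d₂` OF THE TRANSPORTED LOGARITHMS IS SECOND ORDER**: for a `δ`-small `V` (`δ ≤ 1/3`) and `|m|∞ ≤ N`,
`‖(d₂ wlogZ V y)(a<b<c; m)‖ ≤ 72δ² + 3·2((ℓ²/4)δ)(2δ)`, `ℓ = d(N+1) + dN + 1` — the Bianchi identity at the cube `y + m` transported to `y`,
plus three shifted-face unifications. -/
theorem norm_d2_wlogZ_le {δ : ℝ} (hδ0 : 0 ≤ δ) {V : GaugeField P (j + 1) (Matrix.specialUnitaryGroup n ℂ)} (hV : PlaqSmall δ V)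
    (hδ : δ ≤ 1 / 3) (y : Site P (j + 1)) {a b c : Fin P.d} (hab : a < b) (hbc : b < c) (m : Fin P.d → ℤ) (N : ℕ)
    (hm : ∀ i, (m i).natAbs ≤ N) :
    ‖d2 (wlogZ V y) a b c hab hbc m‖ ≤
      72 * δ ^ 2 + 3 * (2 * ((((P.d * (N + 1) + (P.d * N + 1) : ℕ) : ℝ) ^ 2 / 4) * δ) * (2 * δ)) := by
  have hδ' : δ ≤ 1 / 2 := hδ.trans (by norm_num)
  set z := vadd y m with hz
  set T₀ := ctrans V y m with hT₀
  -- the three faces at `m` are exact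
  have e0 : ∀ o : Orient P.d, wlogZ V y o m = conjM T₀ (clog V ⟨z, o.1.1, o.1.2, o.2⟩) := fun o => rfl
  -- the three shifted faces
  have ea := norm_wlogZ_shift_sub_le hδ0 hV hδ' y ⟨(b, c), hbc⟩ m a N hm
  have eb := norm_wlogZ_shift_sub_le hδ0 hV hδ' y ⟨(a, c), hab.trans hbc⟩ m b N hm
  have ec := norm_wlogZ_shift_sub_le hδ0 hV hδ' y ⟨(a, b), hab⟩ m c N hm
  have hmain : conjM T₀ (cubeLog V z a b c hab hbc) =
      conjM T₀ (conjM (V ⟨z, a⟩) (clog V ⟨z.shift a, b, c, hbc⟩)) - wlogZ V y ⟨(b, c), hbc⟩ m -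
        (conjM T₀ (conjM (V ⟨z, b⟩) (clog V ⟨z.shift b, a, c, hab.trans hbc⟩)) - wlogZ V y ⟨(a, c), hab.trans hbc⟩ m) +
        (conjM T₀ (conjM (V ⟨z, c⟩) (clog V ⟨z.shift c, a, b, hab⟩)) - wlogZ V y ⟨(a, b), hab⟩ m) := by
    unfold cubeLog
    rw [e0, e0, e0]
    simp only [conjM_sub, conjM_add]
  have hsplit : d2 (wlogZ V y) a b c hab hbc m = conjM T₀ (cubeLog V z a b c hab hbc) +
      ((wlogZ V y ⟨(b, c), hbc⟩ (m + unitZ a) - conjM T₀ (conjM (V ⟨z, a⟩) (clog V ⟨z.shift a, b, c, hbc⟩))) -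
       (wlogZ V y ⟨(a, c), hab.trans hbc⟩ (m + unitZ b) - conjM T₀ (conjM (V ⟨z, b⟩) (clog V ⟨z.shift b, a, c, hab.trans hbc⟩))) +
       (wlogZ V y ⟨(a, b), hab⟩ (m + unitZ c) - conjM T₀ (conjM (V ⟨z, c⟩) (clog V ⟨z.shift c, a, b, hab⟩)))) := by
    rw [hmain]
    unfold d2
    abel
  rw [hsplit]
  calc _ ≤ ‖conjM T₀ (cubeLog V z a b c hab hbc)‖ +
        ‖(wlogZ V y ⟨(b, c), hbc⟩ (m + unitZ a) - conjM T₀ (conjM (V ⟨z, a⟩) (clog V ⟨z.shift a, b, c, hbc⟩))) -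
          (wlogZ V y ⟨(a, c), hab.trans hbc⟩ (m + unitZ b) - conjM T₀ (conjM (V ⟨z, b⟩) (clog V ⟨z.shift b, a, c, hab.trans hbc⟩))) +
          (wlogZ V y ⟨(a, b), hab⟩ (m + unitZ c) - conjM T₀ (conjM (V ⟨z, c⟩) (clog V ⟨z.shift c, a, b, hab⟩)))‖ := norm_add_le _ _
    _ ≤ 72 * δ ^ 2 + (2 * ((((P.d * (N + 1) + (P.d * N + 1) : ℕ) : ℝ) ^ 2 / 4) * δ) * (2 * δ) +
          2 * ((((P.d * (N + 1) + (P.d * N + 1) : ℕ) : ℝ) ^ 2 / 4) * δ) * (2 * δ) +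
          2 * ((((P.d * (N + 1) + (P.d * N + 1) : ℕ) : ℝ) ^ 2 / 4) * δ) * (2 * δ)) := by
        refine add_le_add ((norm_conjM_le _ _).trans (norm_cubeLog_le hV hδ z hab hbc)) ?_
        exact (norm_add_le _ _).trans (add_le_add ((norm_sub_le _ _).trans (add_le_add ea eb)) ec)
    _ = _ := by ring

end D2

end Summit.QuantumFields.YangMills.Theorems.ApproxLift

end
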